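import Summits.Ventures.PercRepro.MSTightConjTTheorem
import Summits.Ventures.PercRepro.ExcessOneNonTightening

/-!
# The difference family of a genuine twin-free excess-one family is a simplicial complex

Dossier proofs/MINE1-theoremS.md, Addendum 56 (4) — Theorem (YD) in its genuine form (the census
statement of Addendum 43 (3) and Addendum 45 §2). Let `F` be twin-free of Marica–Schönheim excess
one with `∅, univ ∉ F`, empty core and full support. Then `F \\ F` is closed under removing any
element (`erase_mem_diffs_of_genuine`): at a tightening direction by Conjecture (T) (`conjT`:
`Y ⊆ X`), at a non-tightening direction by Theorem (NT) (`erase_mem_diffs_of_mem_diffs`, whose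
nonempty-partner hypothesis is Theorem (SD): `{a} ∈ F \\ F` puts `∅` into `X ∩ Y`, and a
non-tightening direction has `|X ∩ Y| = |K|`). Hence **`F \\ F` is a down-set**
(`isDownSet_diffs_of_genuine`).
-/

namespace PercRepro.MSTight

open Finset
open scoped FinsetFamily

variable {α : Type*} [DecidableEq α] [Fintype α] {F : Finset (Finset α)}

omit [Fintype α] in
/-- At a non-tightening direction of an excess-one family, `|X ∩ Y| = |K|`. -/
theorem card_inter_eq_card_partner_of_not_tight (hF : (F \\ F).card = F.card + 1) {a : α}
    (hP : ¬ Tight (proj a F)) :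
    (diffsX a F ∩ diffsY a F).card = (partner a F).card := by
  have h1 := card_diffs_eq_card_diffs_proj_add a F
  have h2 := card_eq_card_proj_add_card_partner a F
  have h3 : (proj a F).card ≤ (proj a F \\ proj a F).card := card_le_card_diffs _
  have h4 : (partner a F).card ≤ (diffsX a F ∩ diffsY a F).card :=
    (card_le_card_diffs _).trans (card_le_card (diffs_partner_subset a F))
  have h5 : (diffsX a F ∩ diffsY a F).card ≠ (partner a F).card + 1 := fun h =>
    hP ((tight_proj_iff_card_edges hF a).2 h)
  omega

/-- **`F \\ F` is closed under removing any element** for a twin-free excess-one family with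
`∅, univ ∉ F`, empty core and full support. -/
theorem erase_mem_diffs_of_genuine (htw : ∀ a b, Twin F a b → a = b)
    (hF : (F \\ F).card = F.card + 1) (hE : (∅ : Finset α) ∉ F) (hU : (univ : Finset α) ∉ F)
    (hcore : ∀ a, ∃ t ∈ F, a ∉ t) (hsupp : ∀ a, ∃ t ∈ F, a ∈ t) (a : α) {d : Finset α}
    (hd : d ∈ F \\ F) : d.erase a ∈ F \\ F := by
  by_cases had : a ∈ d
  · have hY : d.erase a ∈ diffsY a F :=
      mem_diffsY_iff.2 ⟨notMem_erase a d, by rwa [insert_erase had]⟩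
    by_cases hP : Tight (proj a F)
    · exact (mem_diffsX_iff.1 (conjT F a hF hE hU hcore hsupp hP hY)).1
    · have hε := card_inter_eq_card_partner_of_not_tight hF hP
      have hr : ({a} : Finset α) ∈ F \\ F :=
        singleton_mem_diffs_of_card_diffs_le hF.le (fun b hb => (htw a b hb).symm) (hsupp a) (hcore a)
      have h0 : (∅ : Finset α) ∈ diffsX a F ∩ diffsY a F := by
        obtain ⟨t, ht, -⟩ := hsupp a
        refine mem_inter.2 ⟨mem_diffsX_iff.2 ⟨?_, notMem_empty a⟩,
          mem_diffsY_iff.2 ⟨notMem_empty a, ?_⟩⟩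
        · exact mem_diffs.2 ⟨t, ht, t, ht, Finset.sdiff_self t⟩
        · rw [insert_empty]
          exact hr
      have hK : (partner a F).Nonempty := by
        rw [← card_pos, ← hε]
        exact card_pos.2 ⟨∅, h0⟩
      exact erase_mem_diffs_of_mem_diffs hε hK hd
  · rwa [erase_eq_of_notMem had]

/-- `F \\ F` is closed under removing any set of elements. -/
theorem sdiff_mem_diffs_of_genuine (htw : ∀ a b, Twin F a b → a = b)
    (hF : (F \\ F).card = F.card + 1) (hE : (∅ : Finset α) ∉ F) (hU : (univ : Finset α) ∉ F)
    (hcore : ∀ a, ∃ t ∈ F, a ∉ t) (hsupp : ∀ a, ∃ t ∈ F, a ∈ t) (W : Finset α) {d : Finset α}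
    (hd : d ∈ F \\ F) : d \ W ∈ F \\ F := by
  induction W using Finset.induction_on with
  | empty => rwa [sdiff_empty]
  | insert a W _ ih =>
    rw [sdiff_insert]
    exact erase_mem_diffs_of_genuine htw hF hE hU hcore hsupp a ih

/-- **THEOREM (YD), genuine form: the difference family of a twin-free excess-one family with
`∅, univ ∉ F`, empty core and full support is a simplicial complex (a down-set).** -/
theorem isDownSet_diffs_of_genuine (htw : ∀ a b, Twin F a b → a = b)
    (hF : (F \\ F).card = F.card + 1) (hE : (∅ : Finset α) ∉ F) (hU : (univ : Finset α) ∉ F)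
    (hcore : ∀ a, ∃ t ∈ F, a ∉ t) (hsupp : ∀ a, ∃ t ∈ F, a ∈ t) : IsDownSet (F \\ F) := by
  intro d hd d' hd'
  have h := sdiff_mem_diffs_of_genuine htw hF hE hU hcore hsupp (d \ d') hd
  rwa [Finset.sdiff_sdiff_eq_self hd'] at h

end PercRepro.MSTight
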